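import Summits.Schanuel.Schanuel.Theorems.DiophantineDichotomyApproximationPropertyCleanClusterLever
import Literature.NumberTheory.Transcendental.QuadraticRelationsLogarithmsMahlerWeil
import Mathlib.FieldTheory.PrimitiveElement
import Mathlib.RingTheory.Localization.Integral
import HarnessLib

/-!
# Stub plan `CycleAPIAt3`, P2 `OrbitFloor` — the cluster count from the clean lever (stmt-Schanuel-6117)

Crux `stmt-Schanuel-6117` (`Summit.Schanuel.Schanuel.Theses.DiophantineDichotomy.ApproximationProperty`),
line `orbit-interpolation-determinant`, registered stub `stub_orbitFloor : OrbitFloor` (stub plan P2).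
This file turns the landed CLEAN one-dimensional cluster lever `cleanClusterLever` (no
`k·D·log(2+|x|)` term) into the counting bound the orbit floor needs (all PROVED, no definitions of
statements, no named facts):

* `OrbitFloor.exists_intMinpoly` — a primitive irreducible integer multiple of the minimal polynomial
  of an algebraic number (Gauss's lemma);
* `OrbitFloor.log_mahlerMeasure_eq` — for `y` in a number field `K ⊂ ℂ` with integer minimal
  polynomial `P` of degree `d`: `log M(P) = d · h_K(y) / [K:ℚ]` (the landed
  `MahlerWeil.weilHeight₁_root_eq`, Bombieri–Gubler Prop. 1.6.6);
* `OrbitFloor.card_fiber_le_finrank` — at most `[K : ℚ(y)]` embeddings take a given value at `y`;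
* `OrbitFloor.lever_arith` — the real arithmetic extracting `k² a ≤ 16 d (log(D+2) + log M)` from the
  lever at radius `ρ e^{−a}`, `a ≥ 28 + 4 log(2ρ) + 16 log(D+2)`;
* `OrbitFloor.card_cluster_le` (registered sub-goal `orbitFloor_clusterCount`, uncurried at the end of
  the file) — **the cluster count**: the number
  `N` of complex embeddings `σ` of `K` with `|σ(y) − x| ≤ ρ e^{−a}` satisfies
  `N ≤ max([K:ℚ(y)], √(16([K:ℚ(y)]·D·log(D+2) + D·h_K(y))/a))`, `D = [K:ℚ]` — each root of `P` in the
  disc carries `≤ [K:ℚ(y)]` embeddings, and the roots are counted by the lever.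

Sources: the stub plan (§3 P2, k2 H2/H3: the coordinate chart has no `log D` loss); Y. Bugeaud,
*Approximation by Algebraic Numbers* (CUP 2004), Lemma A.8; Bombieri–Gubler Prop. 1.6.6.
-/

noncomputable section

-- `Summit.Schanuel.Schanuel.…` is the mandated summit/sub-problem namespace (single-conjunct summit), hence:
set_option linter.dupNamespace false

namespace Summit.Schanuel.Schanuel.Cruxes.ApproximationProperty.OrbitInterpolationDeterminant

open Polynomial Real
open Literature.NumberTheory.Transcendental
open scoped BigOperators IntermediateField

namespace OrbitFloor

/-! ## The primitive integer minimal polynomial -/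

/-- **A primitive irreducible integer minimal polynomial.** An algebraic `y` in a `ℚ`-algebra that
is a field is a root of an irreducible `P ∈ ℤ[X]` of degree `deg minpoly_ℚ(y)` (clear denominators
and take the primitive part; Gauss's lemma). [folklore] -/
theorem exists_intMinpoly {K : Type*} [Field K] [CharZero K] [Algebra ℚ K] {y : K}
    (hy : IsIntegral ℚ y) :
    ∃ P : ℤ[X], Irreducible P ∧ P.natDegree = (minpoly ℚ y).natDegree ∧
      eval₂ (Int.castRingHom K) y P = 0 := by
  classical
  set p : ℚ[X] := minpoly ℚ y with hp
  have hpirr : Irreducible p := minpoly.irreducible hy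
  have hp0 : p ≠ 0 := hpirr.ne_zero
  set P₀ : ℤ[X] := IsLocalization.integerNormalization (nonZeroDivisors ℤ) p with hP₀
  obtain ⟨b, hbM, hb⟩ := IsLocalization.integerNormalization_spec (nonZeroDivisors ℤ) p
  have hb0 : (b : ℤ) ≠ 0 := nonZeroDivisors.ne_zero hbM
  have hbq : ((b : ℤ) : ℚ) ≠ 0 := by exact_mod_cast hb0
  have hmap₀ : P₀.map (algebraMap ℤ ℚ) = C ((b : ℤ) : ℚ) * p := by
    rw [hP₀, hb, zsmul_eq_mul, ← C_eq_intCast]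
  have hP₀0 : P₀ ≠ 0 := by
    intro h
    rw [h, Polynomial.map_zero] at hmap₀
    exact (mul_ne_zero (C_ne_zero.mpr hbq) hp0) hmap₀.symm
  have hdeg₀ : P₀.natDegree = p.natDegree := by
    rw [← natDegree_map_eq_of_injective (algebraMap ℤ ℚ).injective_int P₀, hmap₀,
      natDegree_C_mul hbq]
  have hy₀ : aeval y P₀ = 0 := by
    rw [hP₀]
    exact IsLocalization.integerNormalization_aeval_eq_zero (nonZeroDivisors ℤ) p (minpoly.aeval ℚ y)
  set P : ℤ[X] := P₀.primPart with hP
  have hprim : P.IsPrimitive := isPrimitive_primPart P₀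
  have hc0 : P₀.content ≠ 0 := content_eq_zero_iff.not.mpr hP₀0
  have hmap : P.map (algebraMap ℤ ℚ) = C ((P₀.content : ℚ)⁻¹ * ((b : ℤ) : ℚ)) * p := by
    have h1 : P₀.map (algebraMap ℤ ℚ) = C (P₀.content : ℚ) * P.map (algebraMap ℤ ℚ) := by
      conv_lhs => rw [eq_C_content_mul_primPart P₀]
      rw [Polynomial.map_mul, map_C]
      rfl
    have hcq : (P₀.content : ℚ) ≠ 0 := by exact_mod_cast hc0
    rw [hmap₀] at h1
    calc P.map (algebraMap ℤ ℚ) = C (P₀.content : ℚ)⁻¹ * (C (P₀.content : ℚ) * P.map (algebraMap ℤ ℚ)) := by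
          rw [← mul_assoc, ← C_mul, inv_mul_cancel₀ hcq, C_1, one_mul]
      _ = C ((P₀.content : ℚ)⁻¹ * ((b : ℤ) : ℚ)) * p := by rw [← h1, C_mul, mul_assoc]
  refine ⟨P, ?_, ?_, ?_⟩
  · rw [hprim.irreducible_iff_irreducible_map_fraction_map (K := ℚ), hmap]
    refine (irreducible_isUnit_mul ?_).mpr hpirr
    refine Polynomial.isUnit_C.mpr (isUnit_iff_ne_zero.mpr ?_)
    exact mul_ne_zero (inv_ne_zero (by exact_mod_cast hc0)) hbq
  · rw [hP, natDegree_primPart, hdeg₀]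
  · have h1 : aeval y P₀ = algebraMap ℤ K P₀.content * aeval y P := by
      conv_lhs => rw [eq_C_content_mul_primPart P₀]
      rw [map_mul, aeval_C]
    rw [hy₀] at h1
    have hcK : algebraMap ℤ K P₀.content ≠ 0 := by
      rw [algebraMap_int_eq, eq_intCast]
      exact_mod_cast hc0
    have h2 : aeval y P = 0 := (mul_eq_zero.mp h1.symm).resolve_left hcK
    rwa [aeval_def, algebraMap_int_eq] at h2

/-! ## Mahler measure of the minimal polynomial and the height -/

/-- **`log M(P) = d · h_K(y) / [K:ℚ]`** for `y` in a number field `K ⊂ ℂ`, `P ∈ ℤ[X]` irreducible of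
degree `d` with `P(y) = 0`, `h_K` Mathlib's logarithmic height relative to `K` (the landed
`weilHeight₁_root_eq`: `h(y) = log M(P)/d` for the absolute height, and `h = h_K/[K:ℚ]`).
[cite: BombieriGubler2006, Prop. 1.6.6] -/
theorem log_mahlerMeasure_eq (K : IntermediateField ℚ ℂ) [NumberField K] (y : K) {P : ℤ[X]}
    (hP : Irreducible P) (hd : 0 < P.natDegree) (hy : eval₂ (Int.castRingHom K) y P = 0) :
    Real.log (P.map (Int.castRingHom ℂ)).mahlerMeasure =
      P.natDegree * Height.logHeight₁ y / Module.finrank ℚ K := by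
  have hyC : aeval (y : ℂ) P = 0 := by
    rw [aeval_def, algebraMap_int_eq,
      show (y : ℂ) = (algebraMap K ℂ) y from rfl,
      ← RingHom.eq_intCast' ((algebraMap K ℂ).comp (Int.castRingHom K)), ← hom_eval₂, hy,
      map_zero]
  have h := RoyWaldschmidt1997.MahlerWeil.weilHeight₁_root_eq P hP hd hyC K y.2
  rw [weilHeight₁_single_eq K y.2] at h
  have hD : (0 : ℝ) < Module.finrank ℚ K := by exact_mod_cast Module.finrank_pos
  have hdR : (0 : ℝ) < P.natDegree := by exact_mod_cast hd
  rw [div_eq_div_iff hD.ne' hdR.ne'] at h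
  rw [eq_div_iff hD.ne']
  have e : (⟨(y : ℂ), y.2⟩ : K) = y := rfl
  rw [e] at h
  linarith

/-! ## Fibres of `σ ↦ σ(y)` -/

/-- **At most `[K : ℚ(y)]` complex embeddings of a number field `K` take a given value at `y`.**
[folklore] -/
theorem card_fiber_le_finrank {K : Type*} [Field K] [NumberField K] (y : K) (z : ℂ) :
    (Finset.univ.filter fun σ : K →+* ℂ => σ y = z).card ≤ Module.finrank ℚ⟮y⟯ K := by
  classical
  set T := Finset.univ.filter fun σ : K →+* ℂ => σ y = z with hT
  rcases T.eq_empty_or_nonempty with hTe | ⟨σ₀, hσ₀⟩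
  · rw [hTe, Finset.card_empty]
    exact Nat.zero_le _
  have hσ₀y : σ₀ y = z := (Finset.mem_filter.mp hσ₀).2
  set F : IntermediateField ℚ K := ℚ⟮y⟯ with hF
  letI : Algebra F ℂ := (σ₀.comp (algebraMap F K)).toAlgebra
  have hFK : ∀ σ ∈ T, ∀ u : F, σ (algebraMap F K u) = algebraMap F ℂ u := by
    intro σ hσ
    have hσy : σ y = z := (Finset.mem_filter.mp hσ).2
    let φ₁ : F →ₐ[ℚ] ℂ := σ.toRatAlgHom.comp (IsScalarTower.toAlgHom ℚ F K)
    let φ₂ : F →ₐ[ℚ] ℂ := σ₀.toRatAlgHom.comp (IsScalarTower.toAlgHom ℚ F K)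
    have hφ : φ₁ = φ₂ := by
      refine IntermediateField.adjoin_algHom_ext ℚ fun x hx => ?_
      rw [Set.mem_singleton_iff] at hx
      subst hx
      change σ x = σ₀ x
      rw [hσy, hσ₀y]
    intro u
    exact congrArg (fun φ : F →ₐ[ℚ] ℂ => φ u) hφ
  haveI : FiniteDimensional F K := Module.Finite.of_restrictScalars_finite ℚ F K
  let ι : ↥T → (K →ₐ[F] ℂ) := fun σ =>
    { (σ.1 : K →+* ℂ) with commutes' := hFK σ.1 σ.2 }
  have hι : Function.Injective ι := by
    intro σ τ h
    apply Subtype.ext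
    apply RingHom.ext
    intro x
    exact congrArg (fun φ : K →ₐ[F] ℂ => φ x) h
  calc T.card = Fintype.card ↥T := (Fintype.card_coe T).symm
    _ ≤ Fintype.card (K →ₐ[F] ℂ) := Fintype.card_le_of_injective ι hι
    _ = Module.finrank F K := AlgHom.card F K ℂ

/-! ## The real arithmetic of the lever -/

/-- **Arithmetic of the clean lever at radius `ρ e^{−a}`**: if `k ≥ 2`, `1 ≤ d ≤ D`, `M ≥ 1`,
`ρ ≥ 1`, `a ≥ 28 + 4 log(2ρ) + 16 log(D+2)` and
`k(k−1) log(1/(2ρe^{−a})) ≤ 4(d log d + k² log(e d) + (d−1) log M + k)`, then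
`k² a ≤ 16 d (log(D+2) + log M)`. [folklore] -/
theorem lever_arith {k d D M a ρ : ℝ} (hk : 2 ≤ k) (hd1 : 1 ≤ d) (hdD : d ≤ D) (hM : 1 ≤ M)
    (hρ : 1 ≤ ρ) (ha : 28 + 4 * Real.log (2 * ρ) + 16 * Real.log (D + 2) ≤ a)
    (hlever : k * (k - 1) * Real.log (1 / (2 * (ρ * Real.exp (-a)))) ≤
      4 * (d * Real.log d + k ^ 2 * Real.log (Real.exp 1 * d) + (d - 1) * Real.log M + k)) :
    k ^ 2 * a ≤ 16 * d * (Real.log (D + 2) + Real.log M) := by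
  have hρ0 : 0 < ρ := by linarith
  have hd0 : 0 < d := by linarith
  have hlog2ρ : 0 ≤ Real.log (2 * ρ) := Real.log_nonneg (by linarith)
  have hlogD2 : 0 ≤ Real.log (D + 2) := Real.log_nonneg (by linarith)
  have hlogM : 0 ≤ Real.log M := Real.log_nonneg hM
  have hlogd : Real.log d ≤ Real.log (D + 2) := Real.log_le_log hd0 (by linarith)
  have hlogd0 : 0 ≤ Real.log d := Real.log_nonneg hd1
  -- `log(1/(2ρe^{-a})) = a - log(2ρ)`
  have hL : Real.log (1 / (2 * (ρ * Real.exp (-a)))) = a - Real.log (2 * ρ) := by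
    rw [show (1 : ℝ) / (2 * (ρ * Real.exp (-a))) = Real.exp a / (2 * ρ) by
      rw [Real.exp_neg]; field_simp]
    rw [Real.log_div (Real.exp_pos a).ne' (by positivity), Real.log_exp]
  rw [hL] at hlever
  have hloge : Real.log (Real.exp 1 * d) = 1 + Real.log d := by
    rw [Real.log_mul (Real.exp_pos 1).ne' hd0.ne', Real.log_exp]
  rw [hloge] at hlever
  -- lower bound of the left side, upper bound of the right side
  have h1 : k ^ 2 / 2 ≤ k * (k - 1) := by nlinarith
  have ha0 : 0 ≤ a - Real.log (2 * ρ) := by linarith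
  have h2 : k ^ 2 / 2 * (a - Real.log (2 * ρ)) ≤ k * (k - 1) * (a - Real.log (2 * ρ)) :=
    mul_le_mul_of_nonneg_right h1 ha0
  have hk2 : k ≤ k ^ 2 / 2 := by nlinarith
  have h3 : d * Real.log d ≤ d * Real.log (D + 2) := mul_le_mul_of_nonneg_left hlogd hd0.le
  have h4 : (d - 1) * Real.log M ≤ d * Real.log M := by nlinarith
  have h5 : k ^ 2 * (1 + Real.log d) ≤ k ^ 2 * (1 + Real.log (D + 2)) :=
    mul_le_mul_of_nonneg_left (by linarith) (sq_nonneg k)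
  -- combine
  have hmain : k ^ 2 * (a / 2 - Real.log (2 * ρ) / 2 - 6 - 4 * Real.log (D + 2)) ≤
      4 * d * (Real.log (D + 2) + Real.log M) := by nlinarith
  have hbr : a / 4 ≤ a / 2 - Real.log (2 * ρ) / 2 - 6 - 4 * Real.log (D + 2) := by linarith
  have h6 : k ^ 2 * (a / 4) ≤ k ^ 2 * (a / 2 - Real.log (2 * ρ) / 2 - 6 - 4 * Real.log (D + 2)) :=
    mul_le_mul_of_nonneg_left hbr (sq_nonneg k)
  nlinarith

/-! ## The cluster count -/

/-- **The cluster count** (registered below as `orbitFloor_clusterCount`). Let `K ⊂ ℂ` be a number field,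
`D = [K:ℚ]`, `y ∈ K`, `x ∈ ℂ`, `ρ ≥ 1` and `a ≥ 28 + 4 log(2ρ) + 16 log(D+2)`. Then the number of
complex embeddings `σ` of `K` with `|σ(y) − x| ≤ ρ e^{−a}` is at most
`max([K:ℚ(y)], √(16([K:ℚ(y)] D log(D+2) + D h_K(y))/a))`: the values `σ(y)` are roots of the
primitive integer minimal polynomial `P` of `y` (degree `d`, `[K:ℚ(y)] d = D`,
`log M(P) = d h_K(y)/D`), each root carries at most `[K:ℚ(y)]` embeddings, and `k ≥ 2` roots in the
disc cost `k² a ≤ 16 d (log(D+2) + log M(P))` by the clean lever `cleanClusterLever`.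
[cite: Bugeaud2004, Lemma A.8] -/
theorem card_cluster_le (K : IntermediateField ℚ ℂ) [NumberField K] (y : K) (x : ℂ) {ρ a : ℝ}
    (hρ : 1 ≤ ρ)
    (ha : 28 + 4 * Real.log (2 * ρ) + 16 * Real.log (Module.finrank ℚ K + 2) ≤ a) :
    ((Finset.univ.filter fun σ : K →+* ℂ => ‖σ y - x‖ ≤ ρ * Real.exp (-a)).card : ℝ) ≤
      max (Module.finrank ℚ⟮y⟯ K : ℝ)
        (Real.sqrt (16 * ((Module.finrank ℚ⟮y⟯ K : ℝ) * Module.finrank ℚ K *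
            Real.log (Module.finrank ℚ K + 2) +
          Module.finrank ℚ K * Height.logHeight₁ y) / a)) := by
  classical
  set D : ℕ := Module.finrank ℚ K with hDdef
  set e : ℕ := Module.finrank ℚ⟮y⟯ K with hedef
  set r : ℝ := ρ * Real.exp (-a) with hr
  set T := Finset.univ.filter fun σ : K →+* ℂ => ‖σ y - x‖ ≤ r with hT
  have hyint : IsIntegral ℚ y := Algebra.IsIntegral.isIntegral y
  obtain ⟨P, hPirr, hPdeg, hPy⟩ := exists_intMinpoly hyint
  set d : ℕ := (minpoly ℚ y).natDegree with hddef
  have hd1 : 1 ≤ d := minpoly.natDegree_pos hyint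
  have htower : Module.finrank ℚ ℚ⟮y⟯ * e = D := Module.finrank_mul_finrank ℚ ℚ⟮y⟯ K
  have hFd : Module.finrank ℚ ℚ⟮y⟯ = d := IntermediateField.adjoin.finrank hyint
  rw [hFd] at htower
  have hDpos : 0 < D := Module.finrank_pos
  have he1 : 1 ≤ e := by
    rcases Nat.eq_zero_or_pos e with h0 | h0
    · rw [h0, mul_zero] at htower; omega
    · exact h0
  -- the roots of `P` in the disc
  set PC := P.map (Int.castRingHom ℂ) with hPC
  have hP0 : P ≠ 0 := hPirr.ne_zero
  have hPC0 : PC ≠ 0 := by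
    rw [hPC]; exact Polynomial.map_ne_zero_iff (Int.castRingHom ℂ).injective_int |>.mpr hP0
  set k : ℕ := (PC.roots.filter fun z => ‖z - x‖ ≤ r).card with hkdef
  set R' : Finset ℂ := (PC.roots.filter fun z => ‖z - x‖ ≤ r).toFinset with hR'
  have hR'k : R'.card ≤ k := Multiset.toFinset_card_le _
  -- `T` is covered by the fibres over `R'`
  have hroot : ∀ σ ∈ T, σ y ∈ R' := by
    intro σ hσ
    have hσr : ‖σ y - x‖ ≤ r := (Finset.mem_filter.mp hσ).2
    rw [hR', Multiset.mem_toFinset, Multiset.mem_filter]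
    refine ⟨?_, hσr⟩
    rw [mem_roots hPC0, IsRoot, hPC, eval_map]
    have h3 : eval₂ (Int.castRingHom ℂ) (σ y) P = σ (eval₂ (Int.castRingHom K) y P) := by
      rw [hom_eval₂, RingHom.eq_intCast' (σ.comp (Int.castRingHom K))]
    rw [h3, hPy, map_zero]
  have hTle : T.card ≤ e * k := by
    have hsub : T ⊆ R'.biUnion fun z => Finset.univ.filter fun σ : K →+* ℂ => σ y = z := by
      intro σ hσ
      exact Finset.mem_biUnion.mpr ⟨σ y, hroot σ hσ, Finset.mem_filter.mpr ⟨Finset.mem_univ _, rfl⟩⟩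
    calc T.card ≤ (R'.biUnion fun z => Finset.univ.filter fun σ : K →+* ℂ => σ y = z).card :=
          Finset.card_le_card hsub
      _ ≤ ∑ z ∈ R', (Finset.univ.filter fun σ : K →+* ℂ => σ y = z).card := Finset.card_biUnion_le
      _ ≤ ∑ _z ∈ R', e := Finset.sum_le_sum fun z _ => card_fiber_le_finrank y z
      _ = R'.card * e := by rw [Finset.sum_const, smul_eq_mul]
      _ ≤ k * e := Nat.mul_le_mul_right _ hR'k
      _ = e * k := mul_comm _ _
  have hTleR : (T.card : ℝ) ≤ e * k := by exact_mod_cast hTle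
  -- case `k ≤ 1`: at most `e` embeddings
  rcases le_or_gt k 1 with hk1 | hk2
  · refine le_trans ?_ (le_max_left _ _)
    calc (T.card : ℝ) ≤ e * k := hTleR
      _ ≤ e * 1 := by gcongr; exact_mod_cast hk1
      _ = e := mul_one _
  -- case `k ≥ 2`: the lever
  refine le_trans ?_ (le_max_right _ _)
  have hk2' : 2 ≤ k := hk2
  have hkd : k ≤ d := by
    calc k ≤ PC.roots.card := Multiset.card_le_card (Multiset.filter_le _ _)
      _ ≤ PC.natDegree := card_roots' _
      _ = P.natDegree := by rw [hPC, natDegree_map_eq_of_injective (Int.castRingHom ℂ).injective_int]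
      _ = d := hPdeg
  have hd2 : 2 ≤ P.natDegree := by rw [hPdeg]; omega
  have hDR : (1 : ℝ) ≤ D := by exact_mod_cast hDpos
  have hdR : (1 : ℝ) ≤ d := by exact_mod_cast hd1
  have hdDnat : d ≤ D := by
    calc d = d * 1 := (mul_one _).symm
      _ ≤ d * e := Nat.mul_le_mul_left _ he1
      _ = D := htower
  have hdD : (d : ℝ) ≤ D := by exact_mod_cast hdDnat
  have hlog2ρ : 0 ≤ Real.log (2 * ρ) := Real.log_nonneg (by linarith)
  have hlogD2 : 0 ≤ Real.log ((D : ℝ) + 2) := Real.log_nonneg (by linarith)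
  have ha28 : 28 ≤ a := by linarith
  have hr0 : 0 < r := mul_pos (by linarith) (Real.exp_pos _)
  -- `r · 4d ≤ 1` from `a ≥ log(4ρ d)`
  have hr4 : r * (4 * (P.natDegree : ℝ)) ≤ 1 := by
    rw [hPdeg, hr]
    -- `4 ρ d e^{-a} ≤ 1 ⇔ 4ρd ≤ e^a`
    have hlog4ρd : Real.log (4 * ρ * d) ≤ a := by
      rw [show (4 : ℝ) * ρ * d = 2 * (2 * ρ) * d by ring,
        Real.log_mul (by positivity) (by positivity), Real.log_mul (by norm_num) (by positivity)]
      have hl2 : Real.log 2 ≤ 1 := by have := Real.log_two_lt_d9; linarith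
      have hld : Real.log d ≤ Real.log ((D : ℝ) + 2) := Real.log_le_log (by linarith) (by linarith)
      linarith
    have h := Real.exp_le_exp.mpr hlog4ρd
    rw [Real.exp_log (by positivity)] at h
    rw [Real.exp_neg]
    have hea : 0 < Real.exp a := Real.exp_pos a
    rw [show ρ * (Real.exp a)⁻¹ * (4 * (d : ℝ)) = (4 * ρ * d) / Real.exp a by
      rw [div_eq_mul_inv]; ring]
    rwa [div_le_one hea]
  have hlever := cleanClusterLever P x r k hPirr hd2 hr0 hr4 hkdef
  have hM : 1 ≤ PC.mahlerMeasure :=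
    Literature.NumberTheory.DiophantineApproximation.one_le_mahlerMeasure_map P hP0
  have haD : 28 + 4 * Real.log (2 * ρ) + 16 * Real.log ((D : ℝ) + 2) ≤ a := ha
  have hkR : (2 : ℝ) ≤ k := by exact_mod_cast hk2'
  rw [hPdeg] at hlever
  have harith := lever_arith (M := PC.mahlerMeasure) hkR hdR hdD hM hρ haD hlever
  -- `log M(P) = d h_K(y) / D`, so `e² d log M = D h_K(y)` and `e² d = e D`
  have hlogM : Real.log PC.mahlerMeasure = P.natDegree * Height.logHeight₁ y / D :=
    log_mahlerMeasure_eq K y hPirr (by omega) hPy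
  rw [hPdeg] at hlogM
  have heR : (d : ℝ) * e = D := by exact_mod_cast htower
  have ha0 : 0 < a := by linarith
  have hh0 : 0 ≤ Height.logHeight₁ y := Height.zero_le_logHeight₁ y
  -- `(card T)² ≤ e² k² ≤ 16 (e D log(D+2) + D h)/a`
  have hsq : (T.card : ℝ) ^ 2 ≤
      16 * ((e : ℝ) * D * Real.log ((D : ℝ) + 2) + D * Height.logHeight₁ y) / a := by
    have h1 : (T.card : ℝ) ^ 2 ≤ ((e : ℝ) * k) ^ 2 :=
      pow_le_pow_left₀ (Nat.cast_nonneg _) hTleR 2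
    have h2 : ((e : ℝ) * k) ^ 2 * a = (e : ℝ) ^ 2 * (k ^ 2 * a) := by ring
    have h3 : (e : ℝ) ^ 2 * (k ^ 2 * a) ≤ (e : ℝ) ^ 2 * (16 * d * (Real.log ((D : ℝ) + 2) +
        Real.log PC.mahlerMeasure)) := mul_le_mul_of_nonneg_left harith (sq_nonneg _)
    have h4 : (e : ℝ) ^ 2 * (16 * d * (Real.log ((D : ℝ) + 2) + Real.log PC.mahlerMeasure)) =
        16 * ((e : ℝ) * D * Real.log ((D : ℝ) + 2) + D * Height.logHeight₁ y) := by
      rw [hlogM]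
      have hD0 : (D : ℝ) ≠ 0 := by positivity
      field_simp
      rw [← heR]
      ring
    rw [le_div_iff₀ ha0]
    calc (T.card : ℝ) ^ 2 * a ≤ ((e : ℝ) * k) ^ 2 * a := mul_le_mul_of_nonneg_right h1 ha0.le
      _ = (e : ℝ) ^ 2 * (k ^ 2 * a) := h2
      _ ≤ _ := h3
      _ = _ := h4
  calc (T.card : ℝ) = Real.sqrt ((T.card : ℝ) ^ 2) := (Real.sqrt_sq (Nat.cast_nonneg _)).symm
    _ ≤ _ := Real.sqrt_le_sqrt hsq

end OrbitFloor

/-- **Registered sub-goal `orbitFloor_clusterCount` — the cluster count** (uncurried form of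
`OrbitFloor.card_cluster_le`): for a number field `K ⊂ ℂ`, `y ∈ K`, `x ∈ ℂ`, `ρ ≥ 1` and
`a ≥ 28 + 4 log(2ρ) + 16 log([K:ℚ]+2)`, the number of complex embeddings `σ` with
`|σ(y) − x| ≤ ρ e^{−a}` is at most `max([K:ℚ(y)], √(16([K:ℚ(y)] [K:ℚ] log([K:ℚ]+2) + [K:ℚ] h_K(y))/a))`.
[cite: Bugeaud2004, Lemma A.8] -/
theorem orbitFloor_clusterCount : ∀ (K : IntermediateField ℚ ℂ) [NumberField K] (y : K) (x : ℂ) (ρ a : ℝ), 1 ≤ ρ → 28 + 4 * Real.log (2 * ρ) + 16 * Real.log (Module.finrank ℚ K + 2) ≤ a → ((Finset.univ.filter fun σ : K →+* ℂ => ‖σ y - x‖ ≤ ρ * Real.exp (-a)).card : ℝ) ≤ max (Module.finrank ↥(IntermediateField.adjoin ℚ {y}) K : ℝ) (Real.sqrt (16 * ((Module.finrank ↥(IntermediateField.adjoin ℚ {y}) K : ℝ) * Module.finrank ℚ K * Real.log (Module.finrank ℚ K + 2) + Module.finrank ℚ K * Height.logHeight₁ y) / a)) := by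
  intro K _ y x ρ a hρ ha
  exact OrbitFloor.card_cluster_le K y x hρ ha

end Summit.Schanuel.Schanuel.Cruxes.ApproximationProperty.OrbitInterpolationDeterminant

end
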